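import Mathlib
import Summits.ValiantsHypothesis.ValiantsHypothesis.Theorems.DivisionGapPerMultiplesHardDeepPureCount
import Summits.ValiantsHypothesis.ValiantsHypothesis.Theorems.DivisionGapPerMultiplesHardStubLevelSlice
import Summits.ValiantsHypothesis.ValiantsHypothesis.Theorems.DivisionGapPerMultiplesHardStubBoardCompressionGen
import Literature.Computability.AlgebraicComplexity.ArithCircuitProofs

/-!
# `DivisionGap.PerMultiplesHard` (stmt-ValiantsHypothesis-5068), line `uncharged-face-walk`:
the deep pure count for ONE LEVEL of arbitrary margins (stub `deepPureCountLevel`)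

Let `g ∈ ℝ≥0[x_ij]` on the `m × m` board be *torus-homogeneous*: every exponent of `g` has row
margins `R` and column margins `C`.  An exponent is *pure* if it is supported inside the graph
`{(σ j, j)}` of a permutation `σ`.  Fix a level `v ≥ 1` of `R` of size `k_v := #{i | R i = v}` with
`k_v ≥ 3^{(D+2)²}`.  Then the number of DISTINCT level-`v` slices `M|_{R = v} := M.filter (R ·.1 = v)`
of pure exponents `M` of `g` obeys the depth-`D` bound of `DeepPureCount.deepPureCount` on the
`k_v`-board, with `E_D = 3^{(D+1)²}` and `L = L⁺(g)` (the tree's monotone `complexity`):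

  `#slices · 3^{D k_v} ≤ (L+1)^{E_D} · k_v! · (k_v+1)^{E_D} · 2^{D(k_v − ⌊k_v/3⌋) + 3^{(D+2)²}}`.

Proof (the chain of the composition branch of `PerMultiplesHard_of`).  If there is no slice the
left side is `0`.  Otherwise `g` has a pure exponent, so `LevelSlice.stub_levelSlice` gives
`#{R = v} = #{C = v}` and a polynomial `gv` with `L⁺(gv) ≤ L⁺(g)`, margins `v·𝟙{R = v}` /
`v·𝟙{C = v}`, containing the slice of every pure exponent of `g`; a slice of a pure exponent is
pure (`DeepPureCount.pure_filter`), so the slices inject into the pure exponents of `gv`.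
`BoardCompressionGen.stub_boardCompressionGen` compresses `gv` to a `g'` on the `k_v × k_v` board
with all margins `v`, `L⁺(g') ≤ L⁺(gv)` and at least as many pure exponents, and
`DeepPureCount.deepPureCount D k_v` bounds those; finally the bound is monotone in the cost.
[JerrumSnir1982 §3–4; folklore]
-/

noncomputable section

open MvPolynomial Literature.Computability.AlgebraicComplexity
open scoped NNReal BigOperators

namespace Summit.ValiantsHypothesis.ValiantsHypothesis.Theorems.DivisionGap.PerMultiplesHard.DeepPureCountLevel

/-- **The deep pure count for ONE LEVEL of arbitrary margins (stub `deepPureCountLevel`).**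
For a torus-homogeneous `g` (row margins `R`, column margins `C`) on the `m × m` board over `ℝ≥0`
and a level `v ≥ 1` of `R` of size `k_v ≥ 3^{(D+2)²}`, the number of distinct level-`v` slices
`M.filter (R ·.1 = v)` of pure exponents `M` of `g` satisfies
`#slices · 3^{D k_v} ≤ (L⁺(g)+1)^{3^{(D+1)²}} · k_v! · (k_v+1)^{3^{(D+1)²}} · 2^{D(k_v − k_v/3) + 3^{(D+2)²}}`:
slice the level (`LevelSlice.stub_levelSlice`), compress to the `k_v`-board
(`BoardCompressionGen.stub_boardCompressionGen`) and apply the constant-margin deep pure count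
(`DeepPureCount.deepPureCount`). [JerrumSnir1982 §3–4; folklore] -/
theorem deepPureCountLevel :
    ∀ (D m : ℕ) (g : MvPolynomial (Fin m × Fin m) ℝ≥0) (R C : Fin m → ℕ) (v : ℕ),
      (∀ M ∈ g.support, (∀ i, ∑ j, M (i, j) = R i) ∧ (∀ j, ∑ i, M (i, j) = C j)) →
      1 ≤ v → 3 ^ ((D + 2) ^ 2) ≤ (Finset.univ.filter fun i => R i = v).card →
      ((g.support.filter fun M => ∃ σ : Equiv.Perm (Fin m), ∀ e ∈ M.support, e.1 = σ e.2).image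
          (fun M => M.filter (fun e => R e.1 = v))).card *
          3 ^ (D * (Finset.univ.filter fun i => R i = v).card) ≤
        (complexity g + 1) ^ (3 ^ ((D + 1) ^ 2)) *
          (((Finset.univ.filter fun i => R i = v).card).factorial *
            (((Finset.univ.filter fun i => R i = v).card + 1) ^ (3 ^ ((D + 1) ^ 2)) *
              2 ^ (D * ((Finset.univ.filter fun i => R i = v).card -
                (Finset.univ.filter fun i => R i = v).card / 3) + 3 ^ ((D + 2) ^ 2)))) := by
  intro D m g R C v hg hv hkv
  set kv := (Finset.univ.filter fun i => R i = v).card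
  set Img := ((g.support.filter fun M => ∃ σ : Equiv.Perm (Fin m), ∀ e ∈ M.support, e.1 = σ e.2).image
    (fun M => M.filter (fun e => R e.1 = v)))
  -- no slice: the left side is `0`
  rcases Nat.eq_zero_or_pos Img.card with h0 | hImgpos
  · rw [h0, zero_mul]
    exact Nat.zero_le _
  -- a pure exponent of `g` exists
  obtain ⟨M₁, hM₁⟩ := Finset.card_pos.1 hImgpos
  obtain ⟨M, hM, -⟩ := Finset.mem_image.1 hM₁
  obtain ⟨hMg, σ, hσ⟩ := Finset.mem_filter.1 hM
  -- slice the level `v` of `R`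
  obtain ⟨hcardv, gv, hLgv, hmargv, hslv⟩ :=
    LevelSlice.stub_levelSlice m g R C v hv hg ⟨M, hMg, σ, hσ⟩
  -- the slices are pure exponents of `gv`
  have hImgsub : Img ⊆ gv.support.filter
      (fun M => ∃ σ : Equiv.Perm (Fin m), ∀ e ∈ M.support, e.1 = σ e.2) := by
    intro M' hM'
    obtain ⟨M'', hM'', rfl⟩ := Finset.mem_image.1 hM'
    obtain ⟨hM''g, τ, hτ⟩ := Finset.mem_filter.1 hM''
    exact Finset.mem_filter.2 ⟨hslv M'' hM''g ⟨τ, hτ⟩, τ, DeepPureCount.pure_filter hτ _⟩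
  -- compress to the `kv`-board
  have hmargv' : ∀ M ∈ gv.support,
      (∀ i, ∑ j, M (i, j) = if i ∈ (Finset.univ.filter fun i => R i = v) then v else 0) ∧
      (∀ j, ∑ i, M (i, j) = if j ∈ (Finset.univ.filter fun j => C j = v) then v else 0) := by
    intro M hM
    refine ⟨fun i => ?_, fun j => ?_⟩
    · simpa only [Finset.mem_filter, Finset.mem_univ, true_and] using (hmargv M hM).1 i
    · simpa only [Finset.mem_filter, Finset.mem_univ, true_and] using (hmargv M hM).2 j
  obtain ⟨g', hmarg', hLg', hcard'⟩ := BoardCompressionGen.stub_boardCompressionGen m kv v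
    (Finset.univ.filter fun i => R i = v) (Finset.univ.filter fun j => C j = v) gv rfl
    (hcardv ▸ rfl) hv hmargv'
  -- the deep pure count on the `kv`-board, and monotonicity in the cost
  have hdpc := DeepPureCount.deepPureCount D kv hkv v hv g' hmarg'
  have hL' : complexity g' + 1 ≤ complexity g + 1 := Nat.succ_le_succ (hLg'.trans hLgv)
  calc Img.card * 3 ^ (D * kv)
      ≤ (gv.support.filter
          (fun M => ∃ σ : Equiv.Perm (Fin m), ∀ e ∈ M.support, e.1 = σ e.2)).card * 3 ^ (D * kv) :=
        Nat.mul_le_mul_right _ (Finset.card_le_card hImgsub)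
    _ ≤ (g'.support.filter
          (fun M => ∃ σ : Equiv.Perm (Fin kv), ∀ e ∈ M.support, e.1 = σ e.2)).card * 3 ^ (D * kv) :=
        Nat.mul_le_mul_right _ hcard'
    _ ≤ _ := hdpc
    _ ≤ _ := Nat.mul_le_mul_right _ (Nat.pow_le_pow_left hL' _)

end Summit.ValiantsHypothesis.ValiantsHypothesis.Theorems.DivisionGap.PerMultiplesHard.DeepPureCountLevel

end
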